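/-
Copyright (c) 2026 the pub-hodgecm-mathlib formalisation cell (harness21).  Prover seat hodgecm-mathlib-K2E3-p12 (g8), Track B ∕ K2-LIT, h413 = `stmt-HodgeConjecture-24833`,
line `K2_E1_TraceFormulaBeta`, campaign «R8₂-sph EXHAUSTION»: the OBSTRUCTION to the roadcard target «`L²_res ⊓ sph = ℂ·𝟙`» and to the T5-weak letters of ★ p859502 — CHARACTER
VECTORS `χ∘det` are `K`-fixed, residual and orthogonal to the constants (memo `K2/K2E3-p12/g8/MEMO-R8sph-target-false-chidet.K2E3-p12-g8.md`, evidence on the crux item).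
-/
import Summits.HodgeConjecture.HodgeConjecture.Theorems.K2E1CuspFormsMeanZeroSoftUCM   -- ★ `hmean_cm_two` (cusp forms of `U(Φ₂)` have mean zero); transitively ★ `K2E1ConstantLineResidualU2`, ★ `…UnitaryDefsR`
import Mathlib.MeasureTheory.Group.Integral
import HarnessLib

/-!
# K2·E1 — `K2E1ResidualCharacterVectorsU2`: CHARACTER VECTORS ARE RESIDUAL — for a continuous unimodular `ω` on `X = G(K)A_G∖G(𝔸_K)` with `ω(g·x) = c(g)·ω(x)`, constant along the
# `N_i`-fibres: `ℂ·[ω] ≤ L²_res = L²_disc ⊓ (L²_cusp)ᗮ`, `R(k)[ω] = [ω]` when `c|_K = 1`, and `[ω] ⟂ 𝟙` as soon as `c ≢ 1` — so «`(L²_res)^K ⊆ ℂ·𝟙`» FAILS whenever such an `ω` exists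

Track B ∕ K2-LIT, crux h413 = `stmt-HodgeConjecture-24833`, route of record `HCCMUnconditional`; cell `hodgecm-mathlib`, squad K2, ENGINE E1.  THEOREMS ONLY (no `def`, no `instance`,
no `notation`, no named-fact hypothesis, no `sorry`); lane `--supports stmt-HodgeConjecture-24833 --as helper` (count-neutral).  Closes no socket; CORRECTS A ROAD.
THE MATHEMATICS ([MoeglinWaldspurger1995, I.2.18]; [Rogawski1990, §13.5 pp. 204–206]; [BorelJacquet1979, §4.4–§4.6]).  For `U(1,1)_{L∕L⁺}` and a unitary character `χ` of
`U(1)(L⁺)∖U(1)(𝔸_{L⁺})` trivial on `det K_U`, the function `ψ_χ = χ∘det` descends to the automorphic quotient, has modulus `1`, satisfies `ψ_χ(g·x) = χ(det g)·ψ_χ(x)`, and is constant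
along the fibres of every unipotent radical (`det n = 1`).  This file proves, for ANY adelic group datum `𝒢`, automorphic `μ`, family of radicals `𝔓` and any such abstract `ω` (data:
`ω`, its multiplier `c`): §1 products `ω·φ` of `ω` with cusp forms are cusp forms (the constant-term integrand picks up the constant factor `ω(x)`), so (§2) `L²_cusp ⟂ [ω]` as soon as cusp
forms have mean zero (`hmean`, ★ paid at `U(Φ₂)` by `hmean_cm_two`); §3 `R(g)[ω] = c(g⁻¹)•[ω]` (Mathlib `DomMulAct.mk_smul_toLp`), so `ℂ·[ω]` is a closed invariant LINE, irreducible, hence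
`≤ L²_disc` (★ `le_discretePart`), and `[ω]` is `K`-fixed when `c|_K = 1`; §4 if `c(g₀) ≠ 1` for one `g₀` then `∫_X ω dμ = 0` (invariance of `μ`: `∫ω = ∫ω(g₀·) = c(g₀)∫ω`), i.e. `[ω] ⟂ 𝟙`,
so `[ω] ∉ ℂ·𝟙`; HEADS **`span_toLp_le_residualSubspace`** (`ℂ·[ω] ≤ L²_res` modulo `hmean`) and **`not_forall_fixed_residual_mem_span_const`** (the implication «every `K`-fixed residual
vector is constant» is FALSE given such an `ω` with `c ≢ 1`, `c|_K = 1`); §5 the `U(Φ₂)` instances in ★ T9's currency (`cmResidualSubspaceR L 2 μ`, `hmean` discharged by ★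
`hmean_cm_two` through ★ `cmParabolicDataR_two`).  CONSEQUENCE (memo, evidence on the crux item): the ROADCARD target «`cmResidualSubspaceR L 2 μ ⊓ sph = ℂ·𝟙`» and the T5-weak letter
set `(a, f, M; hf, hM, hinj, ha₁)` of ★ p859502 are unsatisfiable for every CM `L` with `h(T¹_{L∕L⁺}; K_U) > 1` (e.g. `L = ℚ(√−23)`: three unramified `χ`), the correct spherical statement
being `(L²_res)^{K_U} = ⊕_χ ℂ·[χ∘det]` (finite-dimensional) — the EXISTENCE of `χ ≠ 1` is number theory NOT formalised here (this file is the formal half: given `ω`, the line is residual,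
`K`-fixed and off `ℂ·𝟙`).
HONEST LABEL: HC_CM is proved only modulo the 7 printed citations (2 remaining named inputs: hLiu418 = `stmt-HodgeConjecture-24832`, h413 = `stmt-HodgeConjecture-24833`) until rung 0
closes; this file asserts no named fact, closes no socket; count-neutral; the socket `sig_K2E1ResidualCompactU2` (compactness) is untouched — only the road's intermediate target changes.

## References
* [MoeglinWaldspurger1995] C. Mœglin, J.-L. Waldspurger, *Spectral decomposition and Eisenstein series* (1995), I.2.18 (residual characters of rank-one groups).
* [Rogawski1990] J. D. Rogawski, *Automorphic Representations of Unitary Groups in Three Variables* (1990), §13.5 (pp. 204–206).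
* [BorelJacquet1979] A. Borel, H. Jacquet, *Automorphic forms and automorphic representations*, Corvallis (1979), §4.4–§4.6.
* [Dixmier1977] J. Dixmier, *C\*-algebras* (1977), §13.1.
-/

set_option autoImplicit false
set_option linter.dupNamespace false  -- the mandated namespace repeats the summit's segment (`HodgeConjecture.HodgeConjecture`)

noncomputable section

open MeasureTheory Measure NumberField ContRepresentation Filter
open scoped InnerProductSpace ComplexConjugate ENNReal
open Literature.NumberTheory.Automorphic Literature.NumberTheory.Automorphic.UnitaryGroup
open Summit.HodgeConjecture.HodgeConjecture.Cruxes.H413.K2E1CuspidalSpectrumUnitary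
open Summit.HodgeConjecture.HodgeConjecture.Cruxes.H413.K2E1ConstantLineResidualU2 (const_one_ne_zero inner_const_one_left)
open Summit.HodgeConjecture.HodgeConjecture.Cruxes.H413.K2E1CuspFormsMeanZeroSoftUCM (hmean_cm_two)

namespace Summit.HodgeConjecture.HodgeConjecture.Cruxes.H413.K2E1ResidualCharacterVectorsU2

universe u

section Generic

variable {K : Type} [Field K] [NumberField K] (𝒢 : AdelicGroupData.{u} K) (μ : Measure 𝒢.automorphicQuotient) [𝒢.IsAutomorphicMeasure μ]

/-! ## §1 Products of cusp forms with `N`-fibre-constant bounded continuous functions are cusp forms -/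

/-- **The constant term of `ω·φ` vanishes when that of `φ` does and `ω` is constant along the `N_i`-fibres** (`ω((x u⁻¹)Γ) = ω(xΓ)` for `u ∈ N_i(𝔸)`): the constant-term integrand of `ω·φ`
at `x` is `ω(xΓ)` times that of `φ`. [cite: BorelJacquet1979, §4.4] -/
theorem constantTermVanishes_mul (𝔓 : 𝒢.ParabolicUnipotentData) {ω φ : 𝒢.automorphicQuotient → ℂ} {i : 𝔓.ι}
    (hωN : ∀ (x : 𝒢.Adelic) (u : 𝔓.radical i), ω (𝒢.toAutomorphicQuotient (x * (u : 𝒢.Adelic)⁻¹)) = ω (𝒢.toAutomorphicQuotient x))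
    (hφ : AdelicGroupData.ConstantTermVanishes 𝔓 φ i) : AdelicGroupData.ConstantTermVanishes 𝔓 (fun y => ω y * φ y) i := by
  intro _ _ ν _ 𝓕 h𝓕 x
  obtain ⟨hφi, hφ0⟩ := hφ ν 𝓕 h𝓕 x
  simp_rw [hωN x]
  exact ⟨hφi.const_mul _, by rw [integral_const_mul, hφ0, mul_zero]⟩

omit [𝒢.IsAutomorphicMeasure μ] in
/-- **`ω·φ` is a cusp form** for a cusp form `φ` and a continuous bounded `ω` constant along every `N_i`-fibre (continuity, `‖ω·φ‖ ≤ C‖φ‖` so square-integrable, §1). [cite: BorelJacquet1979, §4.4–§4.6] -/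
theorem mul_mem_cuspForms (𝔓 : 𝒢.ParabolicUnipotentData) {ω φ : 𝒢.automorphicQuotient → ℂ} (hωc : Continuous ω) {C : ℝ} (hωb : ∀ x, ‖ω x‖ ≤ C)
    (hωN : ∀ (i : 𝔓.ι) (x : 𝒢.Adelic) (u : 𝔓.radical i), ω (𝒢.toAutomorphicQuotient (x * (u : 𝒢.Adelic)⁻¹)) = ω (𝒢.toAutomorphicQuotient x))
    (hφ : φ ∈ 𝒢.cuspForms μ 𝔓) : (fun y => ω y * φ y) ∈ 𝒢.cuspForms μ 𝔓 :=
  ⟨hωc.mul hφ.1, hφ.2.1.of_le_mul (hωc.mul hφ.1).aestronglyMeasurable (Eventually.of_forall fun x => by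
      rw [norm_mul]; exact mul_le_mul_of_nonneg_right (hωb x) (norm_nonneg _)),
    fun i => constantTermVanishes_mul 𝒢 𝔓 (hωN i) (hφ.2.2 i)⟩

/-! ## §2 Square-integrability of `ω`, the pairing `⟪[ω], [φ]⟫ = ∫ conj ω · φ`, and `L²_cusp ⟂ [ω]` modulo «cusp forms have mean zero» -/

/-- A continuous bounded function on the (finite-measure) automorphic quotient is square-integrable (Mathlib `MemLp.of_bound`). [cite: BorelJacquet1979, §4.6] -/
theorem memLp_of_norm_le {ω : 𝒢.automorphicQuotient → ℂ} (hωc : Continuous ω) {C : ℝ} (hωb : ∀ x, ‖ω x‖ ≤ C) : MemLp ω 2 μ :=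
  MemLp.of_bound hωc.aestronglyMeasurable C (Eventually.of_forall hωb)

omit [𝒢.IsAutomorphicMeasure μ] in
/-- `⟪[ω], [φ]⟫ = ∫ conj(ω)·φ dμ` for square-integrable `ω, φ` (Mathlib `L2.inner_def` and the a.e. representatives of `toLp`). [folklore] -/
theorem inner_toLp_toLp {ω φ : 𝒢.automorphicQuotient → ℂ} (hω : MemLp ω 2 μ) (hφ : MemLp φ 2 μ) :
    ⟪(hω.toLp ω : 𝒢.L2 μ), hφ.toLp φ⟫_ℂ = ∫ x, conj (ω x) * φ x ∂μ := by
  rw [L2.inner_def]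
  refine integral_congr_ae ?_
  filter_upwards [hω.coeFn_toLp, hφ.coeFn_toLp] with x hx hy
  rw [hx, hy, RCLike.inner_apply, mul_comm]

/-- **`L²_cusp ≤ (ℂ ∙ [ω])ᗮ` MODULO `hmean`**: for `ω` continuous, bounded, constant along the `N_i`-fibres, and every cusp form of mean zero, `⟪[ω], [φ]⟫ = ∫ conj(ω)·φ = 0` on the
generators (`conj(ω)·φ` is again a cusp form, §1) and the orthogonal complement is closed. [cite: MoeglinWaldspurger1995, I.2.18] [cite: BorelJacquet1979, §4.4–§4.6] -/
theorem cuspidalSubspace_le_orthogonal_span_toLp (𝔓 : 𝒢.ParabolicUnipotentData) (hmean : ∀ φ ∈ 𝒢.cuspForms μ 𝔓, ∫ x, φ x ∂μ = 0)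
    {ω : 𝒢.automorphicQuotient → ℂ} (hωc : Continuous ω) {C : ℝ} (hωb : ∀ x, ‖ω x‖ ≤ C)
    (hωN : ∀ (i : 𝔓.ι) (x : 𝒢.Adelic) (u : 𝔓.radical i), ω (𝒢.toAutomorphicQuotient (x * (u : 𝒢.Adelic)⁻¹)) = ω (𝒢.toAutomorphicQuotient x)) (hω : MemLp ω 2 μ) :
    (𝒢.cuspidalSubspace μ 𝔓).toSubmodule ≤ (ℂ ∙ (hω.toLp ω : 𝒢.L2 μ))ᗮ := by
  rw [AdelicGroupData.toSubmodule_cuspidalSubspace]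
  refine Submodule.topologicalClosure_minimal _ (fun u hu => ?_) (Submodule.isClosed_orthogonal _)
  obtain ⟨φ, rfl⟩ := hu
  rw [Submodule.mem_orthogonal_singleton_iff_inner_right, AdelicGroupData.cuspFormsToLp_apply, inner_toLp_toLp]
  exact hmean _ (mul_mem_cuspForms 𝒢 μ 𝔓 (ω := fun y => conj (ω y)) (Complex.continuous_conj.comp hωc) (fun x => by rw [Complex.norm_conj]; exact hωb x)
    (fun i x v => by rw [hωN i x v]) φ.2)

/-! ## §3 `R(g)[ω] = c(g⁻¹)•[ω]`: the closed invariant line `ℂ·[ω]`, clause `ℂ·[ω] ≤ L²_disc`, `K`-fixedness -/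

/-- **`R(g)[ω] = c(g⁻¹)•[ω]`** for `ω(g·x) = c(g)·ω(x)`: the regular representation acts on `L²` by `(R g f)(x) = f(g⁻¹·x)` (Mathlib `DomMulAct.mk_smul_toLp`). [cite: BorelJacquet1979, §4.6] -/
theorem rightRegular_toLp_eq_smul {ω : 𝒢.automorphicQuotient → ℂ} (hω : MemLp ω 2 μ) {c : 𝒢.Adelic → ℂ}
    (hωeq : ∀ (g : 𝒢.Adelic) (x : 𝒢.automorphicQuotient), ω (g • x) = c g * ω x) (g : 𝒢.Adelic) :
    𝒢.rightRegular μ g (hω.toLp ω) = c g⁻¹ • (hω.toLp ω : 𝒢.L2 μ) := by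
  rw [AdelicGroupData.rightRegular_apply, DomMulAct.mk_smul_toLp, ← MemLp.toLp_const_smul]
  exact (MemLp.toLp_eq_toLp_iff _ _).2 (Eventually.of_forall fun x => by simp only [Pi.smul_apply, smul_eq_mul, hωeq])

/-- **`[ω] ≠ 0` in `L²`** when `‖ω‖ ≡ 1` (the automorphic measure is non-zero). [cite: BorelJacquet1979, §4.6] -/
theorem toLp_ne_zero {ω : 𝒢.automorphicQuotient → ℂ} (hω : MemLp ω 2 μ) (hω1 : ∀ x, ‖ω x‖ = 1) : (hω.toLp ω : 𝒢.L2 μ) ≠ 0 := by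
  have hμ : μ Set.univ ≠ 0 := (isOpen_univ.measure_pos μ ⟨𝒢.toAutomorphicQuotient 1, Set.mem_univ _⟩).ne'
  haveI : NeZero μ := ⟨fun h => hμ (by rw [h, Measure.coe_zero, Pi.zero_apply])⟩
  intro h0
  have h1 : (hω.toLp ω : 𝒢.automorphicQuotient → ℂ) =ᵐ[μ] (0 : 𝒢.automorphicQuotient → ℂ) := by
    rw [h0]; exact Lp.coeFn_zero ℂ 2 μ
  obtain ⟨x, hx⟩ := (hω.coeFn_toLp.symm.trans h1).exists
  have h := hω1 x
  rw [hx, Pi.zero_apply, norm_zero] at h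
  exact zero_ne_one h

/-- **THE LINE `ℂ·[ω]` IS A CLOSED INVARIANT SUBREPRESENTATION, TOPOLOGICALLY IRREDUCIBLE** (invariant by `R(g)[ω] = c(g⁻¹)•[ω]`, closed because finite-dimensional, irreducible because
one-dimensional) — the pattern of ★ `exists_closedSubrep_span_const`. [cite: Dixmier1977, §13.1] [cite: BorelJacquet1979, §4.6] -/
theorem exists_closedSubrep_span_toLp {ω : 𝒢.automorphicQuotient → ℂ} (hω : MemLp ω 2 μ) (hω1 : ∀ x, ‖ω x‖ = 1) {c : 𝒢.Adelic → ℂ}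
    (hωeq : ∀ (g : 𝒢.Adelic) (x : 𝒢.automorphicQuotient), ω (g • x) = c g * ω x) :
    ∃ W : ClosedSubrep (𝒢.rightRegular μ), W.toSubmodule = (ℂ ∙ (hω.toLp ω : 𝒢.L2 μ)) ∧ W.toContRep.IsTopIrreducible := by
  have h1 := toLp_ne_zero 𝒢 μ hω hω1
  obtain ⟨W, hW⟩ : ∃ W : ClosedSubrep (𝒢.rightRegular μ), W.toSubmodule = (ℂ ∙ (hω.toLp ω : 𝒢.L2 μ)) := by
    refine ⟨⟨⟨ℂ ∙ (hω.toLp ω : 𝒢.L2 μ), fun g v hv => ?_⟩, Submodule.closed_of_finiteDimensional _⟩, rfl⟩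
    obtain ⟨a, rfl⟩ := Submodule.mem_span_singleton.1 hv
    change 𝒢.rightRegular μ g (a • hω.toLp ω) ∈ ℂ ∙ (hω.toLp ω : 𝒢.L2 μ)
    rw [map_smul, rightRegular_toLp_eq_smul 𝒢 μ hω hωeq, smul_smul]
    exact Submodule.smul_mem _ _ (Submodule.mem_span_singleton_self _)
  refine ⟨W, hW, ?_⟩
  have hmem : (hω.toLp ω : 𝒢.L2 μ) ∈ W.toSubmodule := by
    rw [hW]
    exact Submodule.mem_span_singleton_self _
  have hfr : Module.finrank ℂ ↥W.toSubmodule = 1 := (LinearEquiv.ofEq _ _ hW).finrank_eq.trans (finrank_span_singleton h1)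
  haveI : IsSimpleModule ℂ ↥W.toSubmodule := isSimpleModule_iff_finrank_eq_one.2 hfr
  refine (ContRepresentation.isTopIrreducible_iff _).2 ⟨⟨⟨⟨_, hmem⟩, 0, fun h => h1 (congrArg Subtype.val h)⟩⟩, fun W' => ?_⟩
  rcases eq_bot_or_eq_top W'.toSubmodule with h | h
  · left
    refine ClosedSubrep.ext fun v => ?_
    rw [← ClosedSubrep.mem_toSubmodule (W := W'), h, Submodule.mem_bot, ClosedSubrep.mem_bot]
  · right
    refine ClosedSubrep.ext fun v => ?_
    rw [← ClosedSubrep.mem_toSubmodule (W := W'), h]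
    exact ⟨fun _ => ClosedSubrep.mem_top v, fun _ => Submodule.mem_top⟩

/-- **`ℂ·[ω] ≤ L²_disc`** — an irreducible closed subrepresentation lies in the discrete spectrum (★ `le_discretePart`). [cite: BorelJacquet1979, §4.6] [cite: MoeglinWaldspurger1995, I.2.18] -/
theorem span_toLp_le_discreteSpectrum {ω : 𝒢.automorphicQuotient → ℂ} (hω : MemLp ω 2 μ) (hω1 : ∀ x, ‖ω x‖ = 1) {c : 𝒢.Adelic → ℂ}
    (hωeq : ∀ (g : 𝒢.Adelic) (x : 𝒢.automorphicQuotient), ω (g • x) = c g * ω x) :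
    (ℂ ∙ (hω.toLp ω : 𝒢.L2 μ)) ≤ (𝒢.discreteSpectrum μ).toSubmodule := by
  obtain ⟨W, hW, hirr⟩ := exists_closedSubrep_span_toLp 𝒢 μ hω hω1 hωeq
  rw [← hW]
  exact ClosedSubrep.toSubmodule_le_iff.2 (le_discretePart hirr)

/-- **`[ω]` IS `K`-FIXED** for any subgroup `K` on which the multiplier is trivial (`R(k)[ω] = c(k⁻¹)•[ω] = [ω]`). [cite: BorelJacquet1979, §4.6] -/
theorem rightRegular_toLp_eq_self {ω : 𝒢.automorphicQuotient → ℂ} (hω : MemLp ω 2 μ) {c : 𝒢.Adelic → ℂ}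
    (hωeq : ∀ (g : 𝒢.Adelic) (x : 𝒢.automorphicQuotient), ω (g • x) = c g * ω x) (K_U : Subgroup 𝒢.Adelic) (hcK : ∀ k ∈ K_U, c k = 1) :
    ∀ k ∈ K_U, 𝒢.rightRegular μ k (hω.toLp ω) = hω.toLp ω := fun k hk => by
  rw [rightRegular_toLp_eq_smul 𝒢 μ hω hωeq, hcK k⁻¹ (K_U.inv_mem hk), one_smul]

/-! ## §4 `∫ ω = 0` when the multiplier is non-trivial; `[ω] ⟂ 𝟙`; `[ω] ∉ ℂ·𝟙`; the heads -/

/-- **`∫_X ω dμ = 0` AS SOON AS `c(g₀) ≠ 1` FOR ONE `g₀`**: `∫ ω = ∫ ω(g₀·x) dμ = c(g₀)·∫ ω` by the invariance of `μ` (Mathlib `integral_smul_eq_self`). [cite: MoeglinWaldspurger1995, I.2.18] -/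
theorem integral_eq_zero_of_apply_ne_one {ω : 𝒢.automorphicQuotient → ℂ} {c : 𝒢.Adelic → ℂ}
    (hωeq : ∀ (g : 𝒢.Adelic) (x : 𝒢.automorphicQuotient), ω (g • x) = c g * ω x) {g₀ : 𝒢.Adelic} (hg₀ : c g₀ ≠ 1) :
    ∫ x, ω x ∂μ = 0 := by
  have h := integral_smul_eq_self (μ := μ) ω (g := g₀)
  simp_rw [hωeq g₀] at h
  rw [integral_const_mul] at h
  have h2 : (c g₀ - 1) * ∫ x, ω x ∂μ = 0 := by rw [sub_mul, one_mul, h, sub_self]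
  exact (mul_eq_zero.1 h2).resolve_left (sub_ne_zero.2 hg₀)

/-- **`⟪𝟙, [ω]⟫ = 0`** when the multiplier is non-trivial (`⟪𝟙, [ω]⟫ = ∫ ω`, ★ `inner_const_one_left`). [cite: MoeglinWaldspurger1995, I.2.18] -/
theorem inner_const_one_toLp_eq_zero {ω : 𝒢.automorphicQuotient → ℂ} (hω : MemLp ω 2 μ) {c : 𝒢.Adelic → ℂ}
    (hωeq : ∀ (g : 𝒢.Adelic) (x : 𝒢.automorphicQuotient), ω (g • x) = c g * ω x) {g₀ : 𝒢.Adelic} (hg₀ : c g₀ ≠ 1) :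
    ⟪(Lp.const 2 μ (1 : ℂ) : 𝒢.L2 μ), hω.toLp ω⟫_ℂ = 0 := by
  rw [inner_const_one_left, integral_congr_ae hω.coeFn_toLp]
  exact integral_eq_zero_of_apply_ne_one 𝒢 μ hωeq hg₀

/-- **`[ω] ∉ ℂ·𝟙`** when `‖ω‖ ≡ 1` and the multiplier is non-trivial: a vector of the line `ℂ·𝟙` orthogonal to `𝟙` is orthogonal to itself. [cite: MoeglinWaldspurger1995, I.2.18] -/
theorem toLp_not_mem_span_const {ω : 𝒢.automorphicQuotient → ℂ} (hω : MemLp ω 2 μ) (hω1 : ∀ x, ‖ω x‖ = 1) {c : 𝒢.Adelic → ℂ}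
    (hωeq : ∀ (g : 𝒢.Adelic) (x : 𝒢.automorphicQuotient), ω (g • x) = c g * ω x) {g₀ : 𝒢.Adelic} (hg₀ : c g₀ ≠ 1) :
    (hω.toLp ω : 𝒢.L2 μ) ∉ ℂ ∙ (Lp.const 2 μ (1 : ℂ) : 𝒢.L2 μ) := by
  intro hmem
  obtain ⟨a, ha⟩ := Submodule.mem_span_singleton.1 hmem
  have h0 := inner_const_one_toLp_eq_zero 𝒢 μ hω hωeq hg₀
  have hself : ⟪(hω.toLp ω : 𝒢.L2 μ), hω.toLp ω⟫_ℂ = 0 :=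
    calc ⟪(hω.toLp ω : 𝒢.L2 μ), hω.toLp ω⟫_ℂ = ⟪a • (Lp.const 2 μ (1 : ℂ) : 𝒢.L2 μ), hω.toLp ω⟫_ℂ := by rw [ha]
      _ = conj a * ⟪(Lp.const 2 μ (1 : ℂ) : 𝒢.L2 μ), hω.toLp ω⟫_ℂ := inner_smul_left _ _ _
      _ = 0 := by rw [h0, mul_zero]
  exact toLp_ne_zero 𝒢 μ hω hω1 (inner_self_eq_zero.1 hself)

/-- **HEAD — `ℂ·[ω] ≤ L²_res = L²_disc ⊓ (L²_cusp)ᗮ`, MODULO «cusp forms have mean zero»** (`hmean`; ★ at `U(Φ₂)`): for `ω` continuous, `‖ω‖ ≡ 1`, `ω(g·x) = c(g)·ω(x)`, constant along every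
`N_i`-fibre — §3 (`≤ L²_disc`, letter-free) and §2 (`⟂ L²_cusp`).  With `ω = 𝟙` this is ★ `span_const_le_residualSubspace`; with `ω = χ∘det`, `χ ≠ 1` unramified, it is a SECOND residual line.
[cite: MoeglinWaldspurger1995, I.2.18] [cite: Rogawski1990, §13.5] -/
theorem span_toLp_le_residualSubspace (𝔓 : 𝒢.ParabolicUnipotentData) (hmean : ∀ φ ∈ 𝒢.cuspForms μ 𝔓, ∫ x, φ x ∂μ = 0)
    {ω : 𝒢.automorphicQuotient → ℂ} (hωc : Continuous ω) (hω1 : ∀ x, ‖ω x‖ = 1) {c : 𝒢.Adelic → ℂ}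
    (hωeq : ∀ (g : 𝒢.Adelic) (x : 𝒢.automorphicQuotient), ω (g • x) = c g * ω x)
    (hωN : ∀ (i : 𝔓.ι) (x : 𝒢.Adelic) (u : 𝔓.radical i), ω (𝒢.toAutomorphicQuotient (x * (u : 𝒢.Adelic)⁻¹)) = ω (𝒢.toAutomorphicQuotient x)) (hω : MemLp ω 2 μ) :
    (ℂ ∙ (hω.toLp ω : 𝒢.L2 μ)) ≤ (residualSubspace 𝒢 μ 𝔓).toSubmodule := by
  change _ ≤ (𝒢.discreteSpectrum μ).toSubmodule ⊓ (𝒢.cuspidalSubspace μ 𝔓).toSubmoduleᗮ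
  exact le_inf (span_toLp_le_discreteSpectrum 𝒢 μ hω hω1 hωeq)
    ((Submodule.le_orthogonal_orthogonal _).trans (Submodule.orthogonal_le (cuspidalSubspace_le_orthogonal_span_toLp 𝒢 μ 𝔓 hmean hωc (fun x => (hω1 x).le) hωN hω)))

/-- **THE OBSTRUCTION — «EVERY `K`-FIXED RESIDUAL VECTOR IS CONSTANT» FAILS WHENEVER A NON-TRIVIAL `K`-UNRAMIFIED CHARACTER VECTOR EXISTS** (modulo `hmean`): given `ω` as in the head with
multiplier `c`, `c|_{K_U} = 1` and `c(g₀) ≠ 1` for some `g₀`, the vector `[ω]` is residual (head), `K_U`-fixed (§3) and outside `ℂ·𝟙` (§4).  This is the formal half of the memo's finding that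
the R8₂-sph roadcard target and the T5-weak letters of ★ p859502 are unsatisfiable when `h(T¹_{L∕L⁺}; K_U) > 1`. [cite: MoeglinWaldspurger1995, I.2.18] [cite: Rogawski1990, §13.5] -/
theorem not_forall_fixed_residual_mem_span_const (𝔓 : 𝒢.ParabolicUnipotentData) (hmean : ∀ φ ∈ 𝒢.cuspForms μ 𝔓, ∫ x, φ x ∂μ = 0)
    {ω : 𝒢.automorphicQuotient → ℂ} (hωc : Continuous ω) (hω1 : ∀ x, ‖ω x‖ = 1) {c : 𝒢.Adelic → ℂ}
    (hωeq : ∀ (g : 𝒢.Adelic) (x : 𝒢.automorphicQuotient), ω (g • x) = c g * ω x)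
    (hωN : ∀ (i : 𝔓.ι) (x : 𝒢.Adelic) (u : 𝔓.radical i), ω (𝒢.toAutomorphicQuotient (x * (u : 𝒢.Adelic)⁻¹)) = ω (𝒢.toAutomorphicQuotient x))
    (K_U : Subgroup 𝒢.Adelic) (hcK : ∀ k ∈ K_U, c k = 1) {g₀ : 𝒢.Adelic} (hg₀ : c g₀ ≠ 1) :
    ¬ ∀ v ∈ (residualSubspace 𝒢 μ 𝔓).toSubmodule, (∀ k ∈ K_U, 𝒢.rightRegular μ k v = v) → v ∈ ℂ ∙ (Lp.const 2 μ (1 : ℂ) : 𝒢.L2 μ) := by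
  intro h
  have hω : MemLp ω 2 μ := memLp_of_norm_le 𝒢 μ hωc fun x => (hω1 x).le
  exact toLp_not_mem_span_const 𝒢 μ hω hω1 hωeq hg₀
    (h _ (span_toLp_le_residualSubspace 𝒢 μ 𝔓 hmean hωc hω1 hωeq hωN hω (Submodule.mem_span_singleton_self _)) (rightRegular_toLp_eq_self 𝒢 μ hω hωeq K_U hcK))

end Generic

/-! ## §5 The `U(Φ₂)_{L∕L⁺}` instances in ★ T9's currency (`cmResidualSubspaceR L 2 μ`), `hmean` discharged by ★ `hmean_cm_two` -/

section CM

variable (L : Type) [Field L] [NumberField L] [IsCMField L]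
  (μ : Measure (UnitaryGroup.cmDatum L 2 (Matrix.of fun i j : Fin 2 => if i.val + j.val + 1 = 2 then (1 : L) else 0)).automorphicQuotient)
  [(UnitaryGroup.cmDatum L 2 (Matrix.of fun i j : Fin 2 => if i.val + j.val + 1 = 2 then (1 : L) else 0)).IsAutomorphicMeasure μ]

/-- The cusp forms of `U(Φ₂)` along the printed radicals `cmParabolicDataR L 2` (= `cmParabolicData L 2`, ★ `cmParabolicDataR_two`) have mean zero — ★ `hmean_cm_two` transported. [cite: MoeglinWaldspurger1995, I.2.18] -/
theorem hmean_cm_twoR : ∀ φ ∈ (UnitaryGroup.cmDatum L 2 (Matrix.of fun i j : Fin 2 => if i.val + j.val + 1 = 2 then (1 : L) else 0)).cuspForms μ (cmParabolicDataR L 2), ∫ x, φ x ∂μ = 0 := by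
  rw [cmParabolicDataR_two]
  exact hmean_cm_two L μ

/-- **CHARACTER VECTORS OF `U(Φ₂)_{L∕L⁺}` ARE RESIDUAL, LETTER-FREE IN `hmean`**: for every continuous unimodular `ω` on `U(Φ₂)(L⁺)∖U(Φ₂)(𝔸_{L⁺})` with multiplier `c` (`ω(g·x) = c(g)·ω(x)`), constant along
the fibres of the printed radicals, `ℂ·[ω] ≤ cmResidualSubspaceR L 2 μ` — e.g. `ω = χ∘det` for a unitary character `χ` of `U(1)(L⁺)∖U(1)(𝔸_{L⁺})` (`det n = 1` on the radical).
[cite: MoeglinWaldspurger1995, I.2.18] [cite: Rogawski1990, §13.5] -/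
theorem span_toLp_le_cmResidualSubspaceR_two
    {ω : (UnitaryGroup.cmDatum L 2 (Matrix.of fun i j : Fin 2 => if i.val + j.val + 1 = 2 then (1 : L) else 0)).automorphicQuotient → ℂ} (hωc : Continuous ω) (hω1 : ∀ x, ‖ω x‖ = 1)
    {c : (UnitaryGroup.cmDatum L 2 (Matrix.of fun i j : Fin 2 => if i.val + j.val + 1 = 2 then (1 : L) else 0)).Adelic → ℂ}
    (hωeq : ∀ g x, ω (g • x) = c g * ω x)
    (hωN : ∀ (i : (cmParabolicDataR L 2).ι) (x : (UnitaryGroup.cmDatum L 2 (Matrix.of fun i j : Fin 2 => if i.val + j.val + 1 = 2 then (1 : L) else 0)).Adelic) (u : (cmParabolicDataR L 2).radical i),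
      ω ((UnitaryGroup.cmDatum L 2 (Matrix.of fun i j : Fin 2 => if i.val + j.val + 1 = 2 then (1 : L) else 0)).toAutomorphicQuotient (x * (u : (UnitaryGroup.cmDatum L 2 (Matrix.of fun i j : Fin 2 => if i.val + j.val + 1 = 2 then (1 : L) else 0)).Adelic)⁻¹)) =
        ω ((UnitaryGroup.cmDatum L 2 (Matrix.of fun i j : Fin 2 => if i.val + j.val + 1 = 2 then (1 : L) else 0)).toAutomorphicQuotient x))
    (hω : MemLp ω 2 μ) :
    (ℂ ∙ (hω.toLp ω : (UnitaryGroup.cmDatum L 2 (Matrix.of fun i j : Fin 2 => if i.val + j.val + 1 = 2 then (1 : L) else 0)).L2 μ)) ≤ (cmResidualSubspaceR L 2 μ).toSubmodule :=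
  span_toLp_le_residualSubspace _ μ (cmParabolicDataR L 2) (hmean_cm_twoR L μ) hωc hω1 hωeq hωN hω

/-- **THE OBSTRUCTION AT `U(Φ₂)_{L∕L⁺}`, IN ★ T9's BYTES** (`K2E1ResidualSphericalLineCMTwoOfLetters.residual_fixed_mem_span_const_cm_two_of_letters`, conclusion negated): if a continuous
unimodular `ω` with multiplier `c`, constant along the printed radicals, `c|_{K_U} = 1` and `c(g₀) ≠ 1` exists (e.g. `χ∘det` for a non-trivial `χ` of `U(1)(L⁺)∖U(1)(𝔸_{L⁺})∕det K_U` — there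
are `h(T¹_{L∕L⁺}; K_U)` such `χ`, three for `L = ℚ(√−23)`), then it is FALSE that every `K_U`-fixed vector of `cmResidualSubspaceR L 2 μ` lies in `ℂ·𝟙`; hence the letters
`(a, f, M; hf, hM, hinj, ha₁)` of ★ p859502 §4 cannot all be supplied for such `L`. [cite: MoeglinWaldspurger1995, I.2.18] [cite: Rogawski1990, §13.5] -/
theorem not_forall_fixed_cmResidual_mem_span_const_two
    {ω : (UnitaryGroup.cmDatum L 2 (Matrix.of fun i j : Fin 2 => if i.val + j.val + 1 = 2 then (1 : L) else 0)).automorphicQuotient → ℂ} (hωc : Continuous ω) (hω1 : ∀ x, ‖ω x‖ = 1)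
    {c : (UnitaryGroup.cmDatum L 2 (Matrix.of fun i j : Fin 2 => if i.val + j.val + 1 = 2 then (1 : L) else 0)).Adelic → ℂ}
    (hωeq : ∀ g x, ω (g • x) = c g * ω x)
    (hωN : ∀ (i : (cmParabolicDataR L 2).ι) (x : (UnitaryGroup.cmDatum L 2 (Matrix.of fun i j : Fin 2 => if i.val + j.val + 1 = 2 then (1 : L) else 0)).Adelic) (u : (cmParabolicDataR L 2).radical i),
      ω ((UnitaryGroup.cmDatum L 2 (Matrix.of fun i j : Fin 2 => if i.val + j.val + 1 = 2 then (1 : L) else 0)).toAutomorphicQuotient (x * (u : (UnitaryGroup.cmDatum L 2 (Matrix.of fun i j : Fin 2 => if i.val + j.val + 1 = 2 then (1 : L) else 0)).Adelic)⁻¹)) =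
        ω ((UnitaryGroup.cmDatum L 2 (Matrix.of fun i j : Fin 2 => if i.val + j.val + 1 = 2 then (1 : L) else 0)).toAutomorphicQuotient x))
    (K_U : Subgroup (UnitaryGroup.cmDatum L 2 (Matrix.of fun i j : Fin 2 => if i.val + j.val + 1 = 2 then (1 : L) else 0)).Adelic) (hcK : ∀ k ∈ K_U, c k = 1)
    {g₀ : (UnitaryGroup.cmDatum L 2 (Matrix.of fun i j : Fin 2 => if i.val + j.val + 1 = 2 then (1 : L) else 0)).Adelic} (hg₀ : c g₀ ≠ 1) :
    ¬ ∀ v ∈ (cmResidualSubspaceR L 2 μ).toSubmodule,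
      (∀ k ∈ K_U, (UnitaryGroup.cmDatum L 2 (Matrix.of fun i j : Fin 2 => if i.val + j.val + 1 = 2 then (1 : L) else 0)).rightRegular μ k v = v) → v ∈ ℂ ∙ (Lp.const 2 μ (1 : ℂ) : (UnitaryGroup.cmDatum L 2 (Matrix.of fun i j : Fin 2 => if i.val + j.val + 1 = 2 then (1 : L) else 0)).L2 μ) :=
  not_forall_fixed_residual_mem_span_const _ μ (cmParabolicDataR L 2) (hmean_cm_twoR L μ) hωc hω1 hωeq hωN K_U hcK hg₀

end CM

end Summit.HodgeConjecture.HodgeConjecture.Cruxes.H413.K2E1ResidualCharacterVectorsU2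

end
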